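import Summits.Ventures.CertifiedArithmetic.LowPrec.SRTreeEnvelopes
import Summits.Ventures.CertifiedArithmetic.LowPrec.SRSpacing
import HarnessLib

/-!
# Summation order under SR: the node second moment (every order, every format)

HONEST FRAMING (venture CertifiedArithmetic / cell `pub-lowprec`): certified error envelopes and
provably optimal rounding/accumulation schemes for low-precision formats under stated cost models;
every table by two implementations; no hardware or vendor claims.

`SRTreeEnvelopes.lean` proved the exact any-order variance identity `Var ŝ_T = treeVar F T` and
the ORDER-BLIND envelope `treeVar ≤ m·G²/4` (`m` roundings, `G` a global spacing bound). Under a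
SPACING LAW `∀ c, InHull F c → ⌈c⌉ − ⌊c⌋ ≤ max q (ρ|c|)` (every minifloat format satisfies it with
`(q, ρ) = (quantum, 2u)`: `SRSpacing.valueSet_gap_le_max`) the node variance is controlled by the
SECOND MOMENT of the node's pre-rounding value, and that second moment is exactly computable from
the subtrees (`treeExp_node_sq`: `E_aE_b (a+b)² = treeVar l + treeVar r + (∑l + ∑r)²`, by mean
independence). So the summation ORDER enters the bound through ONE statistic of the tree,

  `sqNodes T = ∑_{internal nodes v} (exact partial sum at v)²`,

and for every tree `T` with `m` roundings and height `h`, no saturation (`NoSatT`), `κ = ρ²/4`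
(`= u²` in a format):

* `treeVar_le_vbound` — the sharp recursion `V(node) ≤ (1+κ)(V_l + V_r) + κ(∑l+∑r)² + q²/4`;
* `treeVar_le_secondMoment` — the closed form `treeVar ≤ (1+κ)^(h−1) · (κ·sqNodes T + m·q²/4)`;
* `sqNodes_le_height_mul_sq` — `sqNodes T ≤ h·(∑|xᵢ|)²`, hence (`treeVar_le_height`) the
  variance-level form `treeVar ≤ (1+κ)^(h−1)(κ·h·(∑|xᵢ|)² + m q²/4)` of the `√h·u` probabilistic
  tree bounds of the literature ([HallmanIpsen2023] Cor. 13, [CastroEtAl2024] §4.1) — here for an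
  ARBITRARY finite number system with subnormal floor `q`, every tree, exact hypotheses;
* recursive summation as the left comb: `noSatT_comb_iff`, `treeVar_comb` (`= accVar`),
  `sqNodes_comb` (`= ∑ₖ ŝₖ²`, the squared exact partial sums) and `accVar_le_secondMoment`;
* every format: `valueSet_treeVar_le_secondMoment` (`κ = u²`, `q = quantum`),
  `valueSet_treeVar_le_height`, `valueSet_accVar_le_secondMoment`, `valueSet_tree_prob_dev_ge_le`.

Which tree minimises `sqNodes`, and the dimension-free relative variance of balanced trees on
nonnegative data, are `SRTreeDesign.lean`.
-/

namespace Summit.Ventures.CertifiedArithmetic.LowPrec.SR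

open Literature.ComputerArithmetic.ConnollyHighamMary2021
open Finset STree

variable {K : Type*} [Field K] [LinearOrder K] [IsStrictOrderedRing K]

/-! ### The order statistics of a summation tree -/

/-- `sqNodes T = ∑_{internal nodes} (exact partial sum at the node)²` — the order-dependent
quantity that controls the SR variance under a relative spacing law. -/
def sqNodes : STree K → K
  | .leaf _ => 0
  | .node l r => sqNodes l + sqNodes r + (l.exact + r.exact) ^ 2

/-- `absLeaves T = ∑ |xᵢ|` over the leaves. -/
def absLeaves : STree K → K
  | .leaf x => |x|
  | .node l r => absLeaves l + absLeaves r

/-- The recursive second-moment bound: `vbound (leaf) = 0`,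
`vbound (node l r) = (1+κ)(vbound l + vbound r) + κ(∑l + ∑r)² + q²/4`. -/
def vbound (κ q : K) : STree K → K
  | .leaf _ => 0
  | .node l r => (1 + κ) * (vbound κ q l + vbound κ q r) + κ * (l.exact + r.exact) ^ 2 + q ^ 2 / 4

omit [LinearOrder K] [IsStrictOrderedRing K] in
/-- `sqNodes` of a leaf. -/
@[simp] theorem sqNodes_leaf (x : K) : sqNodes (.leaf x) = 0 := rfl

omit [LinearOrder K] [IsStrictOrderedRing K] in
/-- `sqNodes` of a node. -/
@[simp] theorem sqNodes_node (l r : STree K) :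
    sqNodes (.node l r) = sqNodes l + sqNodes r + (l.exact + r.exact) ^ 2 := rfl

/-- `0 ≤ sqNodes`. -/
theorem sqNodes_nonneg : ∀ t : STree K, 0 ≤ sqNodes t
  | .leaf _ => le_rfl
  | .node l r => by
      rw [sqNodes_node]
      nlinarith [sqNodes_nonneg l, sqNodes_nonneg r, sq_nonneg (l.exact + r.exact)]

/-- `0 ≤ absLeaves`. -/
theorem absLeaves_nonneg : ∀ t : STree K, 0 ≤ absLeaves t
  | .leaf x => abs_nonneg x
  | .node l r => add_nonneg (absLeaves_nonneg l) (absLeaves_nonneg r)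

/-- Triangle inequality: `|∑ leaves| ≤ ∑ |leaves|`. -/
theorem abs_exact_le_absLeaves : ∀ t : STree K, |t.exact| ≤ absLeaves t
  | .leaf _ => le_rfl
  | .node l r =>
      (abs_add_le _ _).trans (add_le_add (abs_exact_le_absLeaves l) (abs_exact_le_absLeaves r))

/-! ### The node second moment (mean independence) -/

/-- **Node second moment.** Without saturation in the subtrees, the second moment of a node's
pre-rounding value is `E_aE_b (a + b)² = treeVar l + treeVar r + (∑l + ∑r)²`. -/
theorem treeExp_node_sq (F : Finset K) (l r : STree K) (hl : NoSatT F l) (hr : NoSatT F r) :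
    treeExp F l (fun a => treeExp F r (fun b => (a + b) ^ 2))
      = treeVar F l + treeVar F r + (l.exact + r.exact) ^ 2 := by
  have h1 : ∀ a, treeExp F r (fun b => (a + b) ^ 2) = treeVar F r + (a - (-r.exact)) ^ 2 := by
    intro a
    rw [treeExp_congr F r (g := fun b => (b - (-a)) ^ 2) (fun b => by ring),
      treeExp_sq_sub F r hr]
    ring
  rw [treeExp_congr F l h1, treeExp_add F l, treeExp_const, treeExp_sq_sub F l hl]
  ring

/-- Squaring the spacing law: `(max q (ρ|c|))² ≤ q² + ρ²c²`. -/
theorem max_sq_le (q ρ c : K) : (max q (ρ * |c|)) ^ 2 ≤ q ^ 2 + ρ ^ 2 * c ^ 2 := by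
  rcases le_total q (ρ * |c|) with h | h
  · rw [max_eq_right h, mul_pow, sq_abs]; nlinarith [sq_nonneg q]
  · rw [max_eq_left h]; nlinarith [sq_nonneg (ρ * c)]

/-! ### Growth of the recursive bound: closed form -/

/-- `(1+κ)·vbound T ≤ (1+κ)^h · (κ·sqNodes T + m·q²/4)`. -/
theorem succ_mul_vbound_le {κ : K} (hκ : 0 ≤ κ) (q : K) : ∀ T : STree K,
    (1 + κ) * vbound κ q T ≤ (1 + κ) ^ T.height * (κ * sqNodes T + T.nodes * q ^ 2 / 4)
  | .leaf _ => by simp [vbound, sqNodes, STree.nodes]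
  | .node l r => by
      have h1 := succ_mul_vbound_le hκ q l
      have h2 := succ_mul_vbound_le hκ q r
      simp only [vbound, sqNodes_node, STree.nodes, STree.height]
      set H := max l.height r.height with hH
      have hXl : 0 ≤ κ * sqNodes l + l.nodes * q ^ 2 / 4 := by
        have := sqNodes_nonneg l; positivity
      have hXr : 0 ≤ κ * sqNodes r + r.nodes * q ^ 2 / 4 := by
        have := sqNodes_nonneg r; positivity
      have hone : (1 : K) ≤ 1 + κ := by linarith
      have hpl : (1 + κ) ^ l.height ≤ (1 + κ) ^ H := pow_le_pow_right₀ hone (le_max_left _ _)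
      have hpr : (1 + κ) ^ r.height ≤ (1 + κ) ^ H := pow_le_pow_right₀ hone (le_max_right _ _)
      have hp1 : (1 : K) ≤ (1 + κ) ^ H := one_le_pow₀ hone
      have hk : 0 ≤ 1 + κ := by linarith
      -- `(1+κ)²·vb_l ≤ (1+κ)^{H+1}·X_l`, same for `r`, node term `≤ (1+κ)^{H+1}·(node term)`
      have e1 : (1 + κ) * ((1 + κ) * vbound κ q l) ≤ (1 + κ) * ((1 + κ) ^ H
          * (κ * sqNodes l + l.nodes * q ^ 2 / 4)) :=
        mul_le_mul_of_nonneg_left (h1.trans (mul_le_mul_of_nonneg_right hpl hXl)) hk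
      have e2 : (1 + κ) * ((1 + κ) * vbound κ q r) ≤ (1 + κ) * ((1 + κ) ^ H
          * (κ * sqNodes r + r.nodes * q ^ 2 / 4)) :=
        mul_le_mul_of_nonneg_left (h2.trans (mul_le_mul_of_nonneg_right hpr hXr)) hk
      have e3 : (1 + κ) * (κ * (l.exact + r.exact) ^ 2 + q ^ 2 / 4)
          ≤ (1 + κ) * ((1 + κ) ^ H * (κ * (l.exact + r.exact) ^ 2 + q ^ 2 / 4)) := by
        refine mul_le_mul_of_nonneg_left ?_ hk
        have h0 : 0 ≤ κ * (l.exact + r.exact) ^ 2 + q ^ 2 / 4 := by positivity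
        nlinarith
      rw [pow_succ (1 + κ) H]
      push_cast
      nlinarith [e1, e2, e3]

omit [LinearOrder K] [IsStrictOrderedRing K] in
/-- A tree of height `0` is a leaf, so its bound vanishes. -/
theorem vbound_eq_zero_of_height (κ q : K) : ∀ T : STree K, T.height = 0 → vbound κ q T = 0
  | .leaf _, _ => rfl
  | .node l r, h => by simp [STree.height] at h

/-- Closed form of the recursive bound: `vbound T ≤ (1+κ)^(h−1) · (κ·sqNodes T + m·q²/4)`. -/
theorem vbound_le {κ : K} (hκ : 0 ≤ κ) (q : K) (T : STree K) :
    vbound κ q T ≤ (1 + κ) ^ (T.height - 1) * (κ * sqNodes T + T.nodes * q ^ 2 / 4) := by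
  have hX : 0 ≤ κ * sqNodes T + T.nodes * q ^ 2 / 4 := by have := sqNodes_nonneg T; positivity
  rcases Nat.eq_zero_or_pos T.height with h0 | hpos
  · rw [vbound_eq_zero_of_height κ q T h0]; positivity
  · have h := succ_mul_vbound_le hκ q T
    have hk : (0 : K) < 1 + κ := by linarith
    obtain ⟨j, hj⟩ : ∃ j, T.height = j + 1 := ⟨T.height - 1, by omega⟩
    rw [hj, pow_succ] at h
    rw [hj, Nat.add_sub_cancel]
    have : (1 + κ) * vbound κ q T
        ≤ (1 + κ) * ((1 + κ) ^ j * (κ * sqNodes T + T.nodes * q ^ 2 / 4)) := by linarith [h]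
    exact le_of_mul_le_mul_left this hk

/-! ### `sqNodes ≤ h · (∑|xᵢ|)²` -/

/-- **Depth bound.** `sqNodes T ≤ height T · (∑|xᵢ|)²` (nodes at equal depth have disjoint
leaves). [cite: HallmanIpsen2023, Lemma 5] -/
theorem sqNodes_le_height_mul_sq : ∀ T : STree K, sqNodes T ≤ T.height * absLeaves T ^ 2
  | .leaf _ => by simp [STree.height]
  | .node l r => by
      have h1 := sqNodes_le_height_mul_sq l
      have h2 := sqNodes_le_height_mul_sq r
      have hal := absLeaves_nonneg l
      have har := absLeaves_nonneg r
      have he : (l.exact + r.exact) ^ 2 ≤ (absLeaves l + absLeaves r) ^ 2 := by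
        have := abs_exact_le_absLeaves (.node l r)
        simp only [STree.exact, absLeaves] at this
        calc (l.exact + r.exact) ^ 2 = |l.exact + r.exact| ^ 2 := (sq_abs _).symm
          _ ≤ (absLeaves l + absLeaves r) ^ 2 := by
              rw [sq, sq]; exact mul_self_le_mul_self (abs_nonneg _) this
      simp only [sqNodes_node, STree.height, absLeaves]
      set H := max l.height r.height
      have hHl : (l.height : K) ≤ H := by exact_mod_cast le_max_left _ _
      have hHr : (r.height : K) ≤ H := by exact_mod_cast le_max_right _ _
      have hsl : 0 ≤ absLeaves l ^ 2 := sq_nonneg _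
      have hsr : 0 ≤ absLeaves r ^ 2 := sq_nonneg _
      push_cast
      nlinarith [mul_le_mul_of_nonneg_right hHl hsl, mul_le_mul_of_nonneg_right hHr hsr,
        mul_nonneg (Nat.cast_nonneg (α := K) H) (mul_nonneg hal har)]

/-! ### Recursive summation = the left comb -/

omit [IsStrictOrderedRing K] in
/-- Last-step form of `NoSat`. -/
theorem noSat_succ_last (F : Finset K) : ∀ (n : ℕ) (x : ℕ → K) (s : K),
    NoSat F x (n + 1) s ↔ NoSat F x n s ∧ AllOutcomes F x n (fun a => InHull F (a + x n)) s
  | 0, x, s => by simp [NoSat, AllOutcomes]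
  | n + 1, x, s => by
      rw [NoSat, noSat_succ_last F n (fun i => x (i + 1)), noSat_succ_last F n (fun i => x (i + 1)),
        NoSat, AllOutcomes]
      tauto

omit [IsStrictOrderedRing K] in
/-- The comb's no-saturation predicate is file II's `NoSat`. -/
theorem noSatT_comb_iff (F : Finset K) (x : ℕ → K) (s : K) : ∀ n : ℕ,
    NoSatT F (comb x s n) ↔ NoSat F x n s
  | 0 => by simp [comb, NoSatT, NoSat]
  | n + 1 => by
      rw [comb, NoSatT, noSatT_comb_iff F x s n, noSat_succ_last]
      simp only [NoSatT, AllOut, true_and]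
      rw [allOut_comb_iff]

/-- **The comb's variance is `accVar`** (consistency of the tree and sequence models). -/
theorem treeVar_comb (F : Finset K) (x : ℕ → K) (s : K) (n : ℕ) (h : NoSat F x n s) :
    treeVar F (comb x s n) = accVar F x n s := by
  have hT : NoSatT F (comb x s n) := (noSatT_comb_iff F x s n).mpr h
  rw [← treeExp_sq_sub_exact F _ hT, treeExp_comb, exact_comb, accExp_sq_sub F x n s h, sub_self,
    zero_pow two_ne_zero, add_zero]

omit [LinearOrder K] [IsStrictOrderedRing K] in
/-- The comb's `sqNodes` is the sum of the squared partial sums `ŝₖ = s + ∑_{i<k+1} xᵢ`, `k < n`. -/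
theorem sqNodes_comb (x : ℕ → K) (s : K) : ∀ n : ℕ,
    sqNodes (comb x s n) = ∑ k ∈ range n, (s + ∑ i ∈ range (k + 1), x i) ^ 2
  | 0 => by simp [comb]
  | n + 1 => by
      rw [comb, sqNodes_node, sqNodes_comb x s n, sum_range_succ, exact_comb, sqNodes_leaf,
        STree.exact, sum_range_succ (fun i => x i) n]
      ring

omit [Field K] [LinearOrder K] [IsStrictOrderedRing K] in
/-- The comb has height `n`. -/
theorem height_comb (x : ℕ → K) (s : K) : ∀ n : ℕ, (comb x s n).height = n
  | 0 => rfl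
  | n + 1 => by rw [comb, STree.height, height_comb x s n, STree.height]; simp

/-! ### The second-moment bound under a spacing law -/

section SpacingLaw

variable {F : Finset K} {q ρ : K}
  (hS : ∀ c, InHull F c → roundUp F c - roundDown F c ≤ max q (ρ * |c|))
include hS

/-- One-step variance under the spacing law: `v_F(c) ≤ (q² + ρ²c²)/4` on the hull. -/
theorem srVar_le_of_spacingLaw {c : K} (hc : InHull F c) :
    srVar F c ≤ (q ^ 2 + ρ ^ 2 * c ^ 2) / 4 := by
  refine (srVar_le_gap_sq_div_four F c).trans ?_
  have h0 : 0 ≤ roundUp F c - roundDown F c := sub_nonneg.mpr (roundDown_le_roundUp F c)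
  have h1 := hS c hc
  have h2 : (roundUp F c - roundDown F c) ^ 2 ≤ (max q (ρ * |c|)) ^ 2 := by
    rw [sq, sq]; exact mul_self_le_mul_self h0 h1
  have h3 := max_sq_le q ρ c
  linarith

/-- **Node step.** Under the spacing law and no saturation at the node, the node's expected
conditional variance is at most `κ·(treeVar l + treeVar r + (∑l+∑r)²) + q²/4`, `κ = ρ²/4`. -/
theorem treeExp_node_srVar_le (l r : STree K) (h : NoSatT F (.node l r)) :
    treeExp F l (fun a => treeExp F r (fun b => srVar F (clamp F (a + b))))
      ≤ ρ ^ 2 / 4 * (treeVar F l + treeVar F r + (l.exact + r.exact) ^ 2) + q ^ 2 / 4 := by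
  obtain ⟨hl, hr, hh⟩ := h
  calc treeExp F l (fun a => treeExp F r (fun b => srVar F (clamp F (a + b))))
      ≤ treeExp F l (fun a => treeExp F r (fun b => ρ ^ 2 / 4 * (a + b) ^ 2 + q ^ 2 / 4)) := by
        refine treeExp_mono_of_allOut F l (allOut_mono F l (fun a ha => ?_) hh)
        refine treeExp_mono_of_allOut F r (allOut_mono F r (fun b hb => ?_) ha)
        rw [clamp_eq_self hb]
        have := srVar_le_of_spacingLaw hS hb
        linarith
    _ = ρ ^ 2 / 4 * (treeVar F l + treeVar F r + (l.exact + r.exact) ^ 2) + q ^ 2 / 4 := by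
        have e : ∀ a, treeExp F r (fun b => ρ ^ 2 / 4 * (a + b) ^ 2 + q ^ 2 / 4)
            = ρ ^ 2 / 4 * treeExp F r (fun b => (a + b) ^ 2) + q ^ 2 / 4 := by
          intro a; rw [treeExp_add, treeExp_mul_left, treeExp_const]
        rw [treeExp_congr F l e, treeExp_add, treeExp_const, treeExp_mul_left,
          treeExp_node_sq F l r hl hr]

/-- **Recursive second-moment bound (any order).** Under the spacing law `(q, ρ)` and no
saturation, `treeVar F T ≤ vbound (ρ²/4) q T`. -/
theorem treeVar_le_vbound : ∀ T : STree K, NoSatT F T → treeVar F T ≤ vbound (ρ ^ 2 / 4) q T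
  | .leaf _, _ => le_rfl
  | .node l r, h => by
      have hn := treeExp_node_srVar_le hS l r h
      obtain ⟨hl, hr, -⟩ := h
      have h1 := treeVar_le_vbound l hl
      have h2 := treeVar_le_vbound r hr
      simp only [treeVar, vbound]
      have hκ : 0 ≤ ρ ^ 2 / 4 := by positivity
      nlinarith [mul_le_mul_of_nonneg_left (add_le_add h1 h2) hκ]

/-- **THE SECOND-MOMENT BOUND (any order, any finite number system with a spacing law).**
Without saturation, `Var ŝ_T = treeVar F T ≤ (1 + κ)^(h−1) · (κ · sqNodes T + m · q²/4)`,
`κ = ρ²/4`, `h` the height, `m` the number of roundings: the order enters only through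
`sqNodes`. -/
theorem treeVar_le_secondMoment (T : STree K) (h : NoSatT F T) :
    treeVar F T
      ≤ (1 + ρ ^ 2 / 4) ^ (T.height - 1) * (ρ ^ 2 / 4 * sqNodes T + T.nodes * q ^ 2 / 4) :=
  (treeVar_le_vbound hS T h).trans (vbound_le (by positivity) q T)

/-- Chebyshev with the second-moment bound: `P(|ŝ_T − ∑xᵢ| ≥ t) ≤ bound / t²`. -/
theorem tree_prob_dev_ge_le_secondMoment (T : STree K) (h : NoSatT F T) {t : K} (ht : 0 < t) :
    treeExp F T (devInd t T.exact)
      ≤ (1 + ρ ^ 2 / 4) ^ (T.height - 1) * (ρ ^ 2 / 4 * sqNodes T + T.nodes * q ^ 2 / 4)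
        / t ^ 2 :=
  (tree_prob_dev_ge_le_treeVar F T h ht).trans
    (div_le_div_of_nonneg_right (treeVar_le_secondMoment hS T h) (by positivity))

/-- **`√h` law, variance level (any order).** `treeVar ≤ (1+κ)^(h−1)·(κ·h·(∑|xᵢ|)² + m·q²/4)`. -/
theorem treeVar_le_height (T : STree K) (h : NoSatT F T) :
    treeVar F T ≤ (1 + ρ ^ 2 / 4) ^ (T.height - 1)
      * (ρ ^ 2 / 4 * (T.height * absLeaves T ^ 2) + T.nodes * q ^ 2 / 4) := by
  refine (treeVar_le_secondMoment hS T h).trans (mul_le_mul_of_nonneg_left ?_ (by positivity))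
  have := sqNodes_le_height_mul_sq T
  nlinarith [sq_nonneg ρ]

/-- **Recursive summation under a spacing law**: without saturation,
`accVar ≤ (1+κ)^(n−1) · (κ · ∑ₖ ŝₖ² + n·q²/4)` with `ŝₖ` the exact partial sums — to be compared
with the order-blind `n·G²/4` of `SREnvelopes.accVar_le`. -/
theorem accVar_le_secondMoment (x : ℕ → K) (n : ℕ) (s : K) (h : NoSat F x n s) :
    accVar F x n s ≤ (1 + ρ ^ 2 / 4) ^ (n - 1)
      * (ρ ^ 2 / 4 * ∑ k ∈ range n, (s + ∑ i ∈ range (k + 1), x i) ^ 2 + n * q ^ 2 / 4) := by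
  have := treeVar_le_secondMoment hS (comb x s n) ((noSatT_comb_iff F x s n).mpr h)
  rwa [treeVar_comb F x s n h, height_comb, nodes_comb, sqNodes_comb] at this

end SpacingLaw

/-! ### Every minifloat format: `κ = u²`, `q = quantum` -/

section Formats

open Literature.ComputerArithmetic.FloatingPoint

/-- `(2u)²/4 = u²`. -/
theorem two_mul_unitRoundoff_sq_div_four (φ : Format) :
    (2 * φ.unitRoundoff) ^ 2 / 4 = φ.unitRoundoff ^ 2 := by ring

/-- **Second-moment bound in a format.** For every `Format φ` and every tree with no saturation:
`treeVar ≤ (1 + u²)^(h−1) · (u² · sqNodes T + m · quantum²/4)`. -/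
theorem valueSet_treeVar_le_secondMoment (φ : Format) (T : STree ℚ)
    (h : NoSatT (MiniFloat.valueSet φ) T) :
    treeVar (MiniFloat.valueSet φ) T ≤ (1 + φ.unitRoundoff ^ 2) ^ (T.height - 1)
      * (φ.unitRoundoff ^ 2 * sqNodes T + T.nodes * φ.quantum ^ 2 / 4) := by
  have := treeVar_le_secondMoment (fun c hc => valueSet_gap_le_max φ hc) T h
  rwa [two_mul_unitRoundoff_sq_div_four] at this

/-- … its `√h` form `treeVar ≤ (1 + u²)^(h−1) · (u²·h·(∑|xᵢ|)² + m·quantum²/4)`. -/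
theorem valueSet_treeVar_le_height (φ : Format) (T : STree ℚ)
    (h : NoSatT (MiniFloat.valueSet φ) T) :
    treeVar (MiniFloat.valueSet φ) T ≤ (1 + φ.unitRoundoff ^ 2) ^ (T.height - 1)
      * (φ.unitRoundoff ^ 2 * (T.height * absLeaves T ^ 2) + T.nodes * φ.quantum ^ 2 / 4) := by
  have := treeVar_le_height (fun c hc => valueSet_gap_le_max φ hc) T h
  rwa [two_mul_unitRoundoff_sq_div_four] at this

/-- … recursive summation in a format: `accVar ≤ (1+u²)^(n−1)·(u² ∑ₖ ŝₖ² + n·quantum²/4)`. -/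
theorem valueSet_accVar_le_secondMoment (φ : Format) (x : ℕ → ℚ) (n : ℕ) (s : ℚ)
    (h : NoSat (MiniFloat.valueSet φ) x n s) :
    accVar (MiniFloat.valueSet φ) x n s ≤ (1 + φ.unitRoundoff ^ 2) ^ (n - 1)
      * (φ.unitRoundoff ^ 2 * ∑ k ∈ range n, (s + ∑ i ∈ range (k + 1), x i) ^ 2
        + n * φ.quantum ^ 2 / 4) := by
  have := accVar_le_secondMoment (fun c hc => valueSet_gap_le_max φ hc) x n s h
  rwa [two_mul_unitRoundoff_sq_div_four] at this

/-- … and the Chebyshev tail in a format. -/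
theorem valueSet_tree_prob_dev_ge_le (φ : Format) (T : STree ℚ)
    (h : NoSatT (MiniFloat.valueSet φ) T) {t : ℚ} (ht : 0 < t) :
    treeExp (MiniFloat.valueSet φ) T (devInd t T.exact)
      ≤ (1 + φ.unitRoundoff ^ 2) ^ (T.height - 1)
        * (φ.unitRoundoff ^ 2 * sqNodes T + T.nodes * φ.quantum ^ 2 / 4) / t ^ 2 :=
  (tree_prob_dev_ge_le_treeVar _ T h ht).trans
    (div_le_div_of_nonneg_right (valueSet_treeVar_le_secondMoment φ T h) (by positivity))

end Formats

end Summit.Ventures.CertifiedArithmetic.LowPrec.SR
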